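import Summits.ValiantsHypothesis.ValiantsHypothesis.Theorems.LacunarySymmetroidMatrixDescartesGraftToolkit
import Literature.Analysis.Calculus.JacobiFormula
import Summits.ValiantsHypothesis.ValiantsHypothesis.Theorems.LacunarySymmetroidMatrixDescartesTailGraftBottom

/-!
# TAIL GRAFT, general `m`: a CORANK-ONE end letter is worth `+1` alternation at the SAME format (`(m, K+1)` pencils, every `K`, `N`)

HONEST FRAMING.  Object-search cell `pub-symmetroid`, crux `Theses.LacunarySymmetroid.MatrixDescartes` (stmt-ValiantsHypothesis-18050); typed by the
ideator seat `val-idea-5` (gen 2) (source `ideators/val-idea-5/Lines/…TailGraftGen.lean`, sha16 743e8f0e7fe651e3), PORTED verbatim by val-lit-p4 g11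
(desk RULING #163; namespace `…TailGraft.Gen`; the three helpers `sum_smul_update_add` / `tendsto_pow_div_top` / `tendsto_pow_div_bottom`
are CITED from the m = 2 files `Theorems/LacunarySymmetroidMatrixDescartesTailGraft{,Bottom}.lean` instead of restated), `--supports 18050 --as helper`.
LOWER-bound / construction mathematics in census (alternation) currency; it proves NOTHING about the crux, `DoorA26`, `DoorA34` or
`VP ≠ VNP`.  No `sorry`, no definitions in this file.

PRIOR ART IN THE TREE (credited).  `val-sym-eng-2`'s DoorA34 strata files prove the `(3,4)` instances in chain currency
(`…CensusDoorA34NullEndLift.nineteen_of_nullBottom_eighteen`, `…NullTopLift.nineteen_of_nullTop_eighteen`,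
`…NullNullLift.nineteen_of_nullNull_seventeen`, `…SubStratumLift`), unfolding a singular end letter by `η·kkᵀ` with `kᵀadj(S)k ≠ 0`;
`Cruxes/MatrixDescartes/Lines/tail_graft.lean` (this seat) proves the `m = 2` case for every `K` with the thickening `s • 1`.  THIS FILE is
the common generalisation: ANY `m`, ANY support length `K + 1`, ANY certificate length, end letter `J` with `det J = 0` and
`tr (adj J) ≠ 0` (for symmetric `J`: corank EXACTLY one), thickening `J + s • 1`.

MECHANISM.  `φ(u) := det (J + u•1)` has `φ(0) = det J = 0` and `φ'(0) = tr (adj J)` (row form of Jacobi's formula,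
`Literature.Analysis.Calculus.hasDerivAt_det_rows`), so the sign of `φ(s)` for small `s` is the sign of `s · tr(adj J)` — choosable.  The
rest is the `m = 2` argument verbatim: old certificate signs persist for small `s` (continuity), and far out (`x → ∞`, resp. `x → 0⁺`)
`x^{∓D} F_s(x) → J + s•1`, whose determinant `φ(s)` has the sign we chose opposite to the extreme old sign.

CONTENTS.  §1 `hasDerivAt_det_add_smul_one`, `tendsto_slope_comp_mul`, evaluation/limit helpers (any `m`);  §2
`exists_alternating_tail_top_gen` + `not_posRootLawAt_of_corankOne_top` (`¬ PosRootLawAt m (K+1) N` from an `N`-alternation certificate);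
§3 the bottom mirror `exists_alternating_tail_bottom_gen` + `not_posRootLawAt_of_corankOne_both` (`1 ≤ K`; both ends ⇒
`¬ PosRootLawAt m (K+1) (N+1)`);  §4 the bridge to the `m = 2` file: `trace_adjugate_fin_two` (`tr adj M = tr M` on `2 × 2`).
READING for the census instruments (LAWFIT-2 §9): at `(3,4)` an 18-alternation row keeping 18 after one end is made exactly corank one
(adjugate trace ≠ 0) is a NINETEEN (`¬DoorA34`) — eng-2's criterion, now for every support length and every `m`; at `(4,4)` a corank-one-ended
25-alternation row would be a 26.  [folklore] (Jacobi's formula; continuity of `det`; dominance of the extreme coefficient.)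
-/

-- `Summit.ValiantsHypothesis.ValiantsHypothesis.…` repeats a component by the D-0017 layout; the linter flags it; the name is mandated.
set_option linter.dupNamespace false

open Matrix Finset Filter Topology

namespace Summit.ValiantsHypothesis.ValiantsHypothesis.Theorems.LacunarySymmetroidMatrixDescartes.TailGraft.Gen

open Summit.ValiantsHypothesis.ValiantsHypothesis.Theorems.LacunarySymmetroidMatrixDescartes.Census.Graft
open Summit.ValiantsHypothesis.ValiantsHypothesis.Theorems.LacunarySymmetroidMatrixDescartes.TailGraft
  (sum_smul_update_add tendsto_pow_div_top tendsto_pow_div_bottom)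

/-! ## 1. Jacobi at a singular letter, slope control, evaluation and limit helpers -/

/-- `d/du det (J + u • 1) |_{u=0} = tr (adj J)` (row form of Jacobi's formula, `Literature…hasDerivAt_det_rows`, and
`Matrix.adjugate_apply`). [folklore] -/
theorem hasDerivAt_det_add_smul_one {n : Type*} [Fintype n] [DecidableEq n] (J : Matrix n n ℝ) :
    HasDerivAt (fun u : ℝ => (J + u • (1 : Matrix n n ℝ)).det) J.adjugate.trace 0 := by
  set E : n → n → ℝ := fun i k => (1 : Matrix n n ℝ) i k with hE
  set c : ℝ → n → n → ℝ := fun u i k => J i k + u * E i k with hc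
  have hcurve : HasDerivAt c E 0 := by
    have h1 : HasDerivAt (fun u : ℝ => (fun i k => J i k : n → n → ℝ) + u • E) ((1 : ℝ) • E) 0 :=
      ((hasDerivAt_id (0 : ℝ)).smul_const E).const_add _
    rw [one_smul] at h1
    have hc' : c = fun u => (fun i k => J i k : n → n → ℝ) + u • E := by
      funext u i k; simp [hc, smul_eq_mul]
    rw [hc']; exact h1
  have h := Literature.Analysis.Calculus.hasDerivAt_det_rows hcurve
  have hfun : (fun u => (Matrix.of (c u)).det) = fun u : ℝ => (J + u • (1 : Matrix n n ℝ)).det := by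
    funext u
    refine congrArg Matrix.det ?_
    ext i k
    simp only [hc, hE, Matrix.of_apply, Matrix.add_apply, Matrix.smul_apply, smul_eq_mul]
  have hc0 : c 0 = fun i k => J i k := by
    funext i k; simp [hc]
  have hder : (∑ j, (Matrix.of (Function.update (c 0) j (E j))).det) = J.adjugate.trace := by
    rw [hc0, Matrix.trace]
    refine Finset.sum_congr rfl fun j _ => ?_
    rw [Matrix.diag_apply, Matrix.adjugate_apply]
    congr 1
    ext i k
    simp only [Matrix.of_apply, Matrix.updateRow_apply, Function.update_apply, hE]
    by_cases hij : i = j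
    · simp only [hij, if_true, Matrix.one_apply, Pi.single_apply]
      by_cases hjk : j = k
      · simp [hjk]
      · simp [hjk, Ne.symm hjk]
    · simp only [hij, if_false]
  rw [hfun, hder] at h
  exact h

/-- Slope control: if `φ 0 = 0` and `φ'(0) = c` then `t⁻¹ · φ (κ t) → c κ` as `t → 0⁺`. [folklore] -/
theorem tendsto_slope_comp_mul {φ : ℝ → ℝ} {c : ℝ} (hφ : HasDerivAt φ c 0) (h0 : φ 0 = 0) (κ : ℝ) :
    Tendsto (fun t : ℝ => t⁻¹ * φ (κ * t)) (𝓝[Set.Ioi 0] 0) (𝓝 (c * κ)) := by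
  have hlin : HasDerivAt (fun t : ℝ => κ * t) κ 0 := by
    simpa using (hasDerivAt_id (0 : ℝ)).const_mul κ
  have hφ' : HasDerivAt φ c ((fun t : ℝ => κ * t) 0) := by simpa using hφ
  have hcomp : HasDerivAt (fun t : ℝ => φ (κ * t)) (c * κ) 0 := hφ'.comp 0 hlin
  have ht := hcomp.tendsto_slope_zero_right
  simp only [zero_add, mul_zero, h0, sub_zero, smul_eq_mul] at ht
  exact ht

/-- After division by `x^D` the pencil tends to its top letter (`x → ∞`). [folklore] -/
theorem tendsto_inv_pow_smul_pencil_top {K : ℕ} {n : Type*} [Fintype n] [DecidableEq n] (d : Fin (K + 1) → ℕ) (hd : StrictMono d)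
    (S : Fin (K + 1) → Matrix n n ℝ) :
    Tendsto (fun x : ℝ => (x ^ d (Fin.last K))⁻¹ • ∑ l, x ^ d l • S l) atTop (𝓝 (S (Fin.last K))) := by
  have h : ∀ x : ℝ, (x ^ d (Fin.last K))⁻¹ • (∑ l, x ^ d l • S l) = ∑ l, (x ^ d l * (x ^ d (Fin.last K))⁻¹) • S l := by
    intro x
    rw [Finset.smul_sum]
    refine Finset.sum_congr rfl fun l _ => ?_
    rw [smul_smul, mul_comm]
  simp_rw [h]
  have hlim : S (Fin.last K) = ∑ l, (if l = Fin.last K then (1 : ℝ) else 0) • S l := by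
    simp [ite_smul, Finset.sum_ite_eq']
  rw [hlim]
  exact tendsto_finsetSum _ fun l _ => (tendsto_pow_div_top d hd l).smul_const _

/-- After division by `x^(d 0)` the pencil tends to its bottom letter (`x → 0⁺`). [folklore] -/
theorem tendsto_inv_pow_smul_pencil_bottom {K : ℕ} {n : Type*} [Fintype n] [DecidableEq n] (d : Fin (K + 1) → ℕ)
    (hd : StrictMono d) (S : Fin (K + 1) → Matrix n n ℝ) :
    Tendsto (fun x : ℝ => (x ^ d 0)⁻¹ • ∑ l, x ^ d l • S l) (𝓝[Set.Ioi 0] 0) (𝓝 (S 0)) := by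
  have h : ∀ x : ℝ, (x ^ d 0)⁻¹ • (∑ l, x ^ d l • S l) = ∑ l, (x ^ d l * (x ^ d 0)⁻¹) • S l := by
    intro x
    rw [Finset.smul_sum]
    refine Finset.sum_congr rfl fun l _ => ?_
    rw [smul_smul, mul_comm]
  simp_rw [h]
  have hlim : S 0 = ∑ l, (if l = 0 then (1 : ℝ) else 0) • S l := by
    simp [ite_smul, Finset.sum_ite_eq']
  rw [hlim]
  exact tendsto_finsetSum _ fun l _ => (tendsto_pow_div_bottom d hd l).smul_const _

/-- The sign-choice step shared by both ends: given the extreme old value `dN ≠ 0` and `c = tr(adj J) ≠ 0`, some small `t > 0`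
satisfies every one of finitely many `𝓝 0`-eventual conditions AND makes `det (J + s•1) · dN < 0` for `s = -(dN c) t`. [folklore] -/
theorem exists_scale {n : Type*} [Fintype n] [DecidableEq n] (J : Matrix n n ℝ) (hdet : J.det = 0)
    (hadj : J.adjugate.trace ≠ 0) (dN : ℝ) (hdN : dN ≠ 0) {P : ℝ → Prop} (hP : ∀ᶠ t in 𝓝 (0 : ℝ), P t) :
    ∃ t : ℝ, 0 < t ∧ P t ∧ (J + (-(dN * J.adjugate.trace) * t) • (1 : Matrix n n ℝ)).det * dN < 0 := by
  set c : ℝ := J.adjugate.trace with hc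
  set φ : ℝ → ℝ := fun u => (J + u • (1 : Matrix n n ℝ)).det with hφ
  have hφ0 : φ 0 = 0 := by simp [hφ, hdet]
  have hsl := tendsto_slope_comp_mul (hasDerivAt_det_add_smul_one J) hφ0 (-(dN * c))
  -- `t⁻¹ φ(s t) · dN → -(dN c)² < 0`
  have hlim : Tendsto (fun t : ℝ => t⁻¹ * φ (-(dN * c) * t) * dN) (𝓝[Set.Ioi 0] 0) (𝓝 (c * (-(dN * c)) * dN)) :=
    hsl.mul_const dN
  have hneg : c * (-(dN * c)) * dN < 0 := by
    have h1 : 0 < (dN * c) * (dN * c) := mul_self_pos.mpr (mul_ne_zero hdN hadj)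
    nlinarith [h1]
  have hev : ∀ᶠ t : ℝ in 𝓝[Set.Ioi 0] 0, t⁻¹ * φ (-(dN * c) * t) * dN < 0 := (tendsto_order.1 hlim).2 _ hneg
  obtain ⟨t, ⟨hPt, hlt⟩, htpos⟩ :=
    (((hP.filter_mono nhdsWithin_le_nhds).and hev).and
      (eventually_mem_nhdsWithin : ∀ᶠ t : ℝ in 𝓝[Set.Ioi 0] 0, t ∈ Set.Ioi 0)).exists
  rw [Set.mem_Ioi] at htpos
  refine ⟨t, htpos, hPt, ?_⟩
  have e : φ (-(dN * c) * t) * dN = t * (t⁻¹ * φ (-(dN * c) * t) * dN) := by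
    field_simp
  show φ (-(dN * c) * t) * dN < 0
  rw [e]
  exact mul_neg_of_pos_of_neg htpos hlt

/-! ## 2. The tail graft at the top end, any `m` -/

/-- **TAIL GRAFT (any `m`, top end).**  A top letter `J` with `det J = 0`, `tr(adj J) ≠ 0` is worth one more alternation at the
same format: thicken it to `J + s • 1`; everything else is kept; the new test point is appended beyond `τ N`. [folklore] -/
theorem exists_alternating_tail_top_gen {m K N : ℕ} (d : Fin (K + 1) → ℕ) (S : Fin (K + 1) → Matrix (Fin m) (Fin m) ℝ)
    (hd : StrictMono d) (hS : ∀ l, (S l).IsSymm)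
    (hdet : (S (Fin.last K)).det = 0) (hadj : (S (Fin.last K)).adjugate.trace ≠ 0)
    (τ : Fin (N + 1) → ℝ) (hτ : StrictMono τ) (hpos : ∀ j, 0 < τ j)
    (hne : ∀ j, (∑ l, τ j ^ d l • S l).det ≠ 0)
    (halt : ∀ j : Fin N, (∑ l, τ j.castSucc ^ d l • S l).det * (∑ l, τ j.succ ^ d l • S l).det < 0) :
    ∃ (s : ℝ) (τ' : Fin (N + 1 + 1) → ℝ),
      (∀ l, (Function.update S (Fin.last K) (S (Fin.last K) + s • (1 : Matrix (Fin m) (Fin m) ℝ)) l).IsSymm) ∧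
      StrictMono τ' ∧ (∀ j, 0 < τ' j) ∧
      (∀ j, (∑ l, τ' j ^ d l • Function.update S (Fin.last K) (S (Fin.last K) + s • (1 : Matrix (Fin m) (Fin m) ℝ)) l).det ≠ 0) ∧
      ∀ j : Fin (N + 1),
        (∑ l, τ' j.castSucc ^ d l • Function.update S (Fin.last K) (S (Fin.last K) + s • (1 : Matrix (Fin m) (Fin m) ℝ)) l).det *
        (∑ l, τ' j.succ ^ d l • Function.update S (Fin.last K) (S (Fin.last K) + s • (1 : Matrix (Fin m) (Fin m) ℝ)) l).det < 0 := by
  classical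
  set J : Matrix (Fin m) (Fin m) ℝ := S (Fin.last K) with hJ
  set D : ℕ := d (Fin.last K) with hD
  set G : ℝ → Matrix (Fin m) (Fin m) ℝ := fun x => ∑ l, x ^ d l • S l with hG
  set c : ℝ := J.adjugate.trace with hc
  set dN : ℝ := (G (τ (Fin.last N))).det with hdN
  have hdN0 : dN ≠ 0 := hne (Fin.last N)
  have hGs : ∀ s x : ℝ, (∑ l, x ^ d l • Function.update S (Fin.last K) (S (Fin.last K) + s • (1 : Matrix (Fin m) (Fin m) ℝ)) l)
      = G x + (s * x ^ D) • (1 : Matrix (Fin m) (Fin m) ℝ) := by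
    intro s x
    rw [sum_smul_update_add, smul_smul, mul_comm]
  -- Step 1: small `t > 0` keeps every old sign (continuity) and gives the new top coefficient the sign opposite to `dN`
  have hold : ∀ j : Fin (N + 1), ∀ᶠ t : ℝ in 𝓝 0,
      0 < (G (τ j) + ((-(dN * c) * t) * τ j ^ D) • (1 : Matrix (Fin m) (Fin m) ℝ)).det * (G (τ j)).det := by
    intro j
    have hsc : Continuous fun t : ℝ => (-(dN * c) * t) * τ j ^ D :=
      (continuous_const.mul continuous_id).mul continuous_const
    have hcn : Continuous fun t : ℝ => (G (τ j) + ((-(dN * c) * t) * τ j ^ D) • (1 : Matrix (Fin m) (Fin m) ℝ)).det :=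
      (continuous_const.add (hsc.smul continuous_const)).matrix_det
    have ht := hcn.tendsto 0
    simp only [mul_zero, zero_mul, zero_smul, add_zero] at ht
    exact eventually_mul_pos_of_tendsto ht (hne j)
  obtain ⟨t, htpos, htall, hLdN⟩ := exists_scale J hdet hadj dN hdN0 (eventually_all.2 hold)
  set s : ℝ := -(dN * c) * t with hs
  set L : ℝ := (J + s • (1 : Matrix (Fin m) (Fin m) ℝ)).det with hL
  have hL0 : L ≠ 0 := fun h => by rw [h, zero_mul] at hLdN; exact lt_irrefl 0 hLdN
  -- Step 2: for this `s`, the sign of `det F_s(x)` at large `x` is the sign of `L`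
  have hlim : Tendsto (fun x : ℝ => ((x ^ D)⁻¹ • (G x + (s * x ^ D) • (1 : Matrix (Fin m) (Fin m) ℝ))).det) atTop (𝓝 L) := by
    have h1 : Tendsto (fun x : ℝ => (x ^ D)⁻¹ • G x + s • (1 : Matrix (Fin m) (Fin m) ℝ)) atTop
        (𝓝 (J + s • (1 : Matrix (Fin m) (Fin m) ℝ))) :=
      (tendsto_inv_pow_smul_pencil_top d hd S).add tendsto_const_nhds
    have h2 := ((continuous_id.matrix_det).tendsto _).comp h1
    refine h2.congr' ?_
    filter_upwards [eventually_gt_atTop (0 : ℝ)] with x hx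
    simp only [Function.comp, id]
    rw [smul_add, smul_smul, show (x ^ D)⁻¹ * (s * x ^ D) = s by field_simp]
  obtain ⟨xs, ⟨hxsL, hxsN⟩, hxs0⟩ :=
    (((eventually_mul_pos_of_tendsto hlim hL0).and (eventually_gt_atTop (τ (Fin.last N)))).and
      (eventually_gt_atTop (0 : ℝ))).exists
  have hxsL' : 0 < (G xs + (s * xs ^ D) • (1 : Matrix (Fin m) (Fin m) ℝ)).det * L := by
    have hcs : ((xs ^ D)⁻¹ • (G xs + (s * xs ^ D) • (1 : Matrix (Fin m) (Fin m) ℝ))).det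
        = ((xs ^ D)⁻¹) ^ m * (G xs + (s * xs ^ D) • (1 : Matrix (Fin m) (Fin m) ℝ)).det := by
      rw [Matrix.det_smul, Fintype.card_fin]
    rw [hcs, mul_assoc] at hxsL
    exact (mul_pos_iff_of_pos_left (pow_pos (inv_pos.2 (pow_pos hxs0 _)) m)).1 hxsL
  -- the new test points: `x⋆` appended
  set τ' : Fin (N + 1 + 1) → ℝ := Fin.snoc τ xs with hτ'
  have hτ'c : ∀ j : Fin (N + 1), τ' j.castSucc = τ j := fun j => by simp [hτ']
  have hτ'l : τ' (Fin.last (N + 1)) = xs := by simp [hτ']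
  refine ⟨s, τ', ?_, ?_, ?_, ?_, ?_⟩
  · intro l
    by_cases hl : l = Fin.last K
    · subst hl
      rw [Function.update_self]
      exact (hS _).add ((Matrix.isSymm_one).smul s)
    · rw [Function.update_of_ne hl]; exact hS l
  · refine Fin.strictMono_iff_lt_succ.mpr fun j => ?_
    rcases Fin.eq_castSucc_or_eq_last j with ⟨i, rfl⟩ | rfl
    · rw [hτ'c, show i.castSucc.succ = i.succ.castSucc from Fin.ext rfl, hτ'c]
      exact hτ (Fin.castSucc_lt_succ (i := i))
    · rw [hτ'c, Fin.succ_last, hτ'l]; exact hxsN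
  · intro j
    rcases Fin.eq_castSucc_or_eq_last j with ⟨i, rfl⟩ | rfl
    · rw [hτ'c]; exact hpos i
    · rw [hτ'l]; exact hxs0
  · intro j
    rcases Fin.eq_castSucc_or_eq_last j with ⟨i, rfl⟩ | rfl
    · rw [hτ'c, hGs]
      intro h0
      have := htall i
      rw [h0, zero_mul] at this
      exact lt_irrefl 0 this
    · rw [hτ'l, hGs]
      intro h0
      rw [h0, zero_mul] at hxsL'
      exact lt_irrefl 0 hxsL'
  · intro j
    rcases Fin.eq_castSucc_or_eq_last j with ⟨i, rfl⟩ | rfl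
    · rw [hτ'c, show i.castSucc.succ = i.succ.castSucc from Fin.ext rfl, hτ'c, hGs, hGs]
      exact mul_neg_of_carriers (htall i.castSucc) (htall i.succ) (halt i)
    · rw [hτ'c, Fin.succ_last, hτ'l, hGs, hGs]
      exact mul_neg_of_carriers (htall (Fin.last N)) hxsL' (by rw [mul_comm]; exact hLdN)

/-- **Census corollary (any `m`, top).**  A corank-one-topped `(m, K+1)` pencil with an `N`-alternation certificate refutes
`PosRootLawAt m (K+1) N`. [folklore] -/
theorem not_posRootLawAt_of_corankOne_top {m K N : ℕ} (d : Fin (K + 1) → ℕ) (S : Fin (K + 1) → Matrix (Fin m) (Fin m) ℝ)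
    (hd : StrictMono d) (hS : ∀ l, (S l).IsSymm)
    (hdet : (S (Fin.last K)).det = 0) (hadj : (S (Fin.last K)).adjugate.trace ≠ 0)
    (τ : Fin (N + 1) → ℝ) (hτ : StrictMono τ) (hpos : ∀ j, 0 < τ j)
    (hne : ∀ j, (∑ l, τ j ^ d l • S l).det ≠ 0)
    (halt : ∀ j : Fin N, (∑ l, τ j.castSucc ^ d l • S l).det * (∑ l, τ j.succ ^ d l • S l).det < 0) :
    ¬ Summit.ValiantsHypothesis.ValiantsHypothesis.Theorems.MatrixDescartes.Negative.PosRootLawAt m (K + 1) N := by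
  obtain ⟨s, τ', hS', hτ', hpos', -, halt'⟩ := exists_alternating_tail_top_gen d S hd hS hdet hadj τ hτ hpos hne halt
  have h := not_posRootLawAt_of_alternating (m := m) (by omega) d _ hS' τ' hτ' hpos' halt'
  simpa using h

/-! ## 3. The bottom mirror and both ends, any `m` -/

/-- **TAIL GRAFT (any `m`, bottom end).** [folklore] -/
theorem exists_alternating_tail_bottom_gen {m K N : ℕ} (d : Fin (K + 1) → ℕ) (S : Fin (K + 1) → Matrix (Fin m) (Fin m) ℝ)
    (hd : StrictMono d) (hS : ∀ l, (S l).IsSymm)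
    (hdet : (S 0).det = 0) (hadj : (S 0).adjugate.trace ≠ 0)
    (τ : Fin (N + 1) → ℝ) (hτ : StrictMono τ) (hpos : ∀ j, 0 < τ j)
    (hne : ∀ j, (∑ l, τ j ^ d l • S l).det ≠ 0)
    (halt : ∀ j : Fin N, (∑ l, τ j.castSucc ^ d l • S l).det * (∑ l, τ j.succ ^ d l • S l).det < 0) :
    ∃ (s : ℝ) (τ' : Fin (N + 1 + 1) → ℝ),
      (∀ l, (Function.update S 0 (S 0 + s • (1 : Matrix (Fin m) (Fin m) ℝ)) l).IsSymm) ∧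
      StrictMono τ' ∧ (∀ j, 0 < τ' j) ∧
      (∀ j, (∑ l, τ' j ^ d l • Function.update S 0 (S 0 + s • (1 : Matrix (Fin m) (Fin m) ℝ)) l).det ≠ 0) ∧
      ∀ j : Fin (N + 1),
        (∑ l, τ' j.castSucc ^ d l • Function.update S 0 (S 0 + s • (1 : Matrix (Fin m) (Fin m) ℝ)) l).det *
        (∑ l, τ' j.succ ^ d l • Function.update S 0 (S 0 + s • (1 : Matrix (Fin m) (Fin m) ℝ)) l).det < 0 := by
  classical
  set J : Matrix (Fin m) (Fin m) ℝ := S 0 with hJ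
  set D : ℕ := d 0 with hD
  set G : ℝ → Matrix (Fin m) (Fin m) ℝ := fun x => ∑ l, x ^ d l • S l with hG
  set c : ℝ := J.adjugate.trace with hc
  set dN : ℝ := (G (τ 0)).det with hdN
  have hdN0 : dN ≠ 0 := hne 0
  have hGs : ∀ s x : ℝ, (∑ l, x ^ d l • Function.update S 0 (S 0 + s • (1 : Matrix (Fin m) (Fin m) ℝ)) l)
      = G x + (s * x ^ D) • (1 : Matrix (Fin m) (Fin m) ℝ) := by
    intro s x
    rw [sum_smul_update_add, smul_smul, mul_comm]
  have hold : ∀ j : Fin (N + 1), ∀ᶠ t : ℝ in 𝓝 0,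
      0 < (G (τ j) + ((-(dN * c) * t) * τ j ^ D) • (1 : Matrix (Fin m) (Fin m) ℝ)).det * (G (τ j)).det := by
    intro j
    have hsc : Continuous fun t : ℝ => (-(dN * c) * t) * τ j ^ D :=
      (continuous_const.mul continuous_id).mul continuous_const
    have hcn : Continuous fun t : ℝ => (G (τ j) + ((-(dN * c) * t) * τ j ^ D) • (1 : Matrix (Fin m) (Fin m) ℝ)).det :=
      (continuous_const.add (hsc.smul continuous_const)).matrix_det
    have ht := hcn.tendsto 0
    simp only [mul_zero, zero_mul, zero_smul, add_zero] at ht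
    exact eventually_mul_pos_of_tendsto ht (hne j)
  obtain ⟨t, htpos, htall, hLdN⟩ := exists_scale J hdet hadj dN hdN0 (eventually_all.2 hold)
  set s : ℝ := -(dN * c) * t with hs
  set L : ℝ := (J + s • (1 : Matrix (Fin m) (Fin m) ℝ)).det with hL
  have hL0 : L ≠ 0 := fun h => by rw [h, zero_mul] at hLdN; exact lt_irrefl 0 hLdN
  have hlim : Tendsto (fun x : ℝ => ((x ^ D)⁻¹ • (G x + (s * x ^ D) • (1 : Matrix (Fin m) (Fin m) ℝ))).det)
      (𝓝[Set.Ioi 0] 0) (𝓝 L) := by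
    have h1 : Tendsto (fun x : ℝ => (x ^ D)⁻¹ • G x + s • (1 : Matrix (Fin m) (Fin m) ℝ)) (𝓝[Set.Ioi 0] 0)
        (𝓝 (J + s • (1 : Matrix (Fin m) (Fin m) ℝ))) :=
      (tendsto_inv_pow_smul_pencil_bottom d hd S).add tendsto_const_nhds
    have h2 := ((continuous_id.matrix_det).tendsto _).comp h1
    refine h2.congr' ?_
    filter_upwards [self_mem_nhdsWithin] with x hx
    rw [Set.mem_Ioi] at hx
    simp only [Function.comp, id]
    rw [smul_add, smul_smul, show (x ^ D)⁻¹ * (s * x ^ D) = s by field_simp]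
  have hlt0 : ∀ᶠ x : ℝ in 𝓝[Set.Ioi 0] 0, x < τ 0 :=
    (eventually_lt_nhds (hpos 0)).filter_mono nhdsWithin_le_nhds
  obtain ⟨xs, ⟨hxsL, hxsN⟩, hxs0⟩ :=
    (((eventually_mul_pos_of_tendsto hlim hL0).and hlt0).and
      (eventually_mem_nhdsWithin : ∀ᶠ x : ℝ in 𝓝[Set.Ioi 0] 0, x ∈ Set.Ioi 0)).exists
  rw [Set.mem_Ioi] at hxs0
  have hxsL' : 0 < (G xs + (s * xs ^ D) • (1 : Matrix (Fin m) (Fin m) ℝ)).det * L := by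
    have hcs : ((xs ^ D)⁻¹ • (G xs + (s * xs ^ D) • (1 : Matrix (Fin m) (Fin m) ℝ))).det
        = ((xs ^ D)⁻¹) ^ m * (G xs + (s * xs ^ D) • (1 : Matrix (Fin m) (Fin m) ℝ)).det := by
      rw [Matrix.det_smul, Fintype.card_fin]
    rw [hcs, mul_assoc] at hxsL
    exact (mul_pos_iff_of_pos_left (pow_pos (inv_pos.2 (pow_pos hxs0 _)) m)).1 hxsL
  set τ' : Fin (N + 1 + 1) → ℝ := Fin.cons xs τ with hτ'
  have hτ's : ∀ j : Fin (N + 1), τ' j.succ = τ j := fun j => by simp [hτ']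
  have hτ'0 : τ' 0 = xs := by simp [hτ']
  refine ⟨s, τ', ?_, ?_, ?_, ?_, ?_⟩
  · intro l
    by_cases hl : l = 0
    · subst hl
      rw [Function.update_self]
      exact (hS _).add ((Matrix.isSymm_one).smul s)
    · rw [Function.update_of_ne hl]; exact hS l
  · refine Fin.strictMono_iff_lt_succ.mpr fun j => ?_
    rcases Fin.eq_zero_or_eq_succ j with rfl | ⟨i, rfl⟩
    · rw [Fin.castSucc_zero, hτ'0, hτ's]; exact hxsN
    · rw [show i.succ.castSucc = i.castSucc.succ from Fin.ext rfl, hτ's, hτ's]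
      exact hτ (Fin.castSucc_lt_succ (i := i))
  · intro j
    rcases Fin.eq_zero_or_eq_succ j with rfl | ⟨i, rfl⟩
    · rw [hτ'0]; exact hxs0
    · rw [hτ's]; exact hpos i
  · intro j
    rcases Fin.eq_zero_or_eq_succ j with rfl | ⟨i, rfl⟩
    · rw [hτ'0, hGs]
      intro h0
      rw [h0, zero_mul] at hxsL'
      exact lt_irrefl 0 hxsL'
    · rw [hτ's, hGs]
      intro h0
      have := htall i
      rw [h0, zero_mul] at this
      exact lt_irrefl 0 this
  · intro j
    rcases Fin.eq_zero_or_eq_succ j with rfl | ⟨i, rfl⟩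
    · rw [Fin.castSucc_zero, hτ'0, hτ's, hGs, hGs]
      exact mul_neg_of_carriers hxsL' (htall 0) hLdN
    · rw [show i.succ.castSucc = i.castSucc.succ from Fin.ext rfl, hτ's, hτ's, hGs, hGs]
      exact mul_neg_of_carriers (htall i.castSucc) (htall i.succ) (halt i)

/-- **Census corollary (any `m`, both ends).**  Both end letters singular with non-zero adjugate trace (`1 ≤ K`) and an
`N`-alternation certificate refute `PosRootLawAt m (K+1) (N+1)`. [folklore] -/
theorem not_posRootLawAt_of_corankOne_both {m K N : ℕ} (hK : 1 ≤ K) (d : Fin (K + 1) → ℕ)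
    (S : Fin (K + 1) → Matrix (Fin m) (Fin m) ℝ) (hd : StrictMono d) (hS : ∀ l, (S l).IsSymm)
    (hdet0 : (S 0).det = 0) (hadj0 : (S 0).adjugate.trace ≠ 0)
    (hdetl : (S (Fin.last K)).det = 0) (hadjl : (S (Fin.last K)).adjugate.trace ≠ 0)
    (τ : Fin (N + 1) → ℝ) (hτ : StrictMono τ) (hpos : ∀ j, 0 < τ j)
    (hne : ∀ j, (∑ l, τ j ^ d l • S l).det ≠ 0)
    (halt : ∀ j : Fin N, (∑ l, τ j.castSucc ^ d l • S l).det * (∑ l, τ j.succ ^ d l • S l).det < 0) :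
    ¬ Summit.ValiantsHypothesis.ValiantsHypothesis.Theorems.MatrixDescartes.Negative.PosRootLawAt m (K + 1) (N + 1) := by
  have hl0 : (Fin.last K : Fin (K + 1)) ≠ 0 := by
    intro h
    have := congrArg Fin.val h
    simp at this
    omega
  obtain ⟨s, τ', hS', hτ', hpos', hne', halt'⟩ :=
    exists_alternating_tail_bottom_gen d S hd hS hdet0 hadj0 τ hτ hpos hne halt
  set S' := Function.update S 0 (S 0 + s • (1 : Matrix (Fin m) (Fin m) ℝ)) with hS'd
  have htop : S' (Fin.last K) = S (Fin.last K) := by rw [hS'd, Function.update_of_ne hl0]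
  have h := not_posRootLawAt_of_corankOne_top d S' hd hS' (by rw [htop]; exact hdetl) (by rw [htop]; exact hadjl)
    τ' hτ' hpos' hne' halt'
  simpa using h

/-! ## 4. Bridge to the `m = 2` file -/

/-- On `2 × 2` matrices `tr (adj M) = tr M`; so for a symmetric rank-one `2 × 2` letter (`det = 0`, `M ≠ 0`, hence `tr M ≠ 0`,
`tail_graft.trace_ne_zero_of_det_eq_zero`) the hypotheses of this file are those of `Lines/tail_graft.lean`. [folklore] -/
theorem trace_adjugate_fin_two (M : Matrix (Fin 2) (Fin 2) ℝ) : M.adjugate.trace = M.trace := by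
  rw [Matrix.adjugate_fin_two, Matrix.trace_fin_two, Matrix.trace_fin_two]
  simp [add_comm]

end Summit.ValiantsHypothesis.ValiantsHypothesis.Theorems.LacunarySymmetroidMatrixDescartes.TailGraft.Gen
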